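import Summits.QuantumFields.YangMills.Theorems.BalabanUVNodesN15BackgroundV1CoarseTriple
import Summits.QuantumFields.YangMills.Theorems.BalabanUVNodesN15BackgroundV1ByName
import HarnessLib

/-!
# Route «BalabanUVNodes» (K4 «SpineRates»), node N15 = NE2, BACKGROUND LAYER — `NE2PlusOperator` BY NAME WITH THE GAUGE FIELD LIVE AND THE COARSE `V′₁` AT
# THE MEAN FIELD's OWN TRIPLE `(Ā, Ā∘s⁻¹, ∇*Ā)`: the four (3.42) entries, `EtaRateIneq342` per index, and the node theorem — g3's chain with the
# pairing-consistent coarse side (the block-translation law the one added hypothesis)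

Cell `pub-ymgap`, seat `pub-ymgap-dag-n15-c` (generation g4; R134 ACCELERATION SEAT, strategy s1; HUMAN RULING D-0062; chair R424 venue; `bears_on: R4∕N15`).
Filed `--supports stmt-QuantumFields-19912 --as helper` (K3‴ `SpineGivenEndpointR13`; KEY TABLE WORDS-133; helper, count-neutral).  Imports BY NAME, nothing in the
tree modified: this seat's `…N15BackgroundV1CoarseTriple` (**`v1C_letters_of_gauge`**), V2 `…N15BackgroundV1ByName` (`gV1c35`, `le_gV1c35`; the texts of
`hasMaj_v1_entries` ∕ `etaRateIneq342_v1` ∕ `ne2PlusOperator_v1` are the templates), g3 `…N15BackgroundV1Gauge` (`v1GaugeBg`, `v1GaugeInstance`), g0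
(`hasMaj_entries_of_letters`, `etaRateIneq342_of_hasMaj`, `entryMajorant_le_etaRateShape`, `bgConst`∕`bgConst1`, `opFamily`, `opGeo_len`), n15-b A2 (`one_le_pref4`).

CONTENTS (namespace `…N15.BackgroundLayer`).  §1 **`hasMaj_v1GC_entries`** (the four entries under the guard; ONE application of `hasMaj_entries_of_letters` to
`v1C_letters_of_gauge`).  §2 `v1GOpsC4` (def: the four entry operators at `A′`, coarse coefficients at the derived triple of `gavgM π A′`), `v1GCFamily4` (def: the
kernel family over g3's paired gauge instance), **`etaRateIneq342_v1GC`**.  §3 ★ **`ne2PlusOperator_v1GC`**: g3's node theorem with the block-translation law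
`π_i((s′_{i,μ})^{N_i} x′) = s_{i,μ}(π_i x′)`, `η_i = N_i η′_i` added and `c′ = (2+|J|)(1+C₀)c₃₅`, `a₀ = (2·gV1c35(2c′)·(βc_r+1))⁻¹`.

HONEST FRAMING ∕ LIMITS.  Transport = fibrewise mean (linearised (C3)); `U ≡ 1` shapes of (3.52) (`V′₂`, `F′_{1,k}` not here — the words files carry them); crude
constants; generic carriers (the realised King-model knit is the sequel `…N15VectorPieceV1Coarse`).  NE2⁺ NOT PRINTED; count-neutral (typed 28∕28 · discharged
unchanged); NOT a discharge of N15; one finite lattice at fixed ε — NOT infinite volume, NOT OS on ℝ⁴, NOT a mass gap, NOT Clay.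
-/

noncomputable section

open scoped BigOperators

namespace Summit.QuantumFields.YangMills.BalabanUVNodes.N15.BackgroundLayer

open Literature.MathematicalPhysics.QuantumFieldTheory.Balaban1983to89
open Literature.MathematicalPhysics.QuantumFieldTheory.Balaban1983to89.B11SectG (BlockNorm HasMaj RowSum)
open Literature.MathematicalPhysics.QuantumFieldTheory.Balaban1983to89.T4EtaRate (PairedInstance EtaRateIneq342 NE2PlusOperator rateFactor)
open Literature.MathematicalPhysics.QuantumFieldTheory.Balaban1983to89.T4EtaRateDefect (idef rateWeight)
open Literature.MathematicalPhysics.QuantumFieldTheory.Balaban1983to89.T4EtaRateCoeffDefect (pull)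
open Literature.MathematicalPhysics.QuantumFieldTheory.Balaban1983to89.B6RandomWalk (Triangle254)
open Summit.QuantumFields.YangMills.BalabanUVNodes.N15.OperatorReadout (opGeo opFamily opGeo_len etaRateIneq342_of_hasMaj)
open Summit.QuantumFields.YangMills.BalabanUVNodes.N15.MatrixSpecies (liftMap liftBlk basisConst basisConst_nonneg)

/-! ## §1 The four entries under the guard -/

section Guard

variable {X X' J ι : Type} [Fintype X] [Fintype X'] [Fintype J] [Fintype ι] [DecidableEq X] [DecidableEq X'] [DecidableEq J] [DecidableEq ι]
  {𝔄 : Type} [NormedRing 𝔄] [NormedAlgebra ℝ 𝔄] [CompleteSpace 𝔄] (e : 𝔄 ≃L[ℝ] (ι → ℝ)) {g : B6.Geometry} (blk : X → g.Site) (π : X' → X)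

variable {G S D₃ : (X × ι → ℝ) →ₗ[ℝ] (X × ι → ℝ)} {D SD : J ⊕ J → (X × ι → ℝ) →ₗ[ℝ] (X × ι → ℝ)} {G' S' D₃' : (X' × ι → ℝ) →ₗ[ℝ] (X' × ι → ℝ)}
  {D' SD' : J ⊕ J → (X' × ι → ℝ) →ₗ[ℝ] (X' × ι → ℝ)}

/-- **THE FOUR ENTRY DEFECTS OF THE `V′₁(A)` PAIR WITH THE COARSE SIDE AT THE MEAN FIELD's OWN TRIPLE.**  V2's `hasMaj_v1_entries` verbatim in its `U ≡ 1`
layer and guard, but over ONE gauge field `A′` with C² letters at `c` (g3 carrier), commuting fine shifts, `C_π`-step-connected fibres, the block-translation law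
`π∘(s′_μ)^N = s_μ∘π`, `η = Nη′`, constants `(2+|J|)c ≤ c′`, `(1+|J|)C_π·cMα₀η′ ≤ c′Mα₀θ`, guard `2(2c′)a₀ ≤ 1`, `β·gV1c35(2c′)a₀·c_r ≤ ½`: fine coefficients at the
derived triple `(A′, A′∘s′⁻¹, ∇′*A′)`, COARSE COEFFICIENTS AT `(Ā, Ā∘s⁻¹, ∇*Ā)`, `Ā = gavgM π A′` — ONE application of `hasMaj_entries_of_letters` to
`v1C_letters_of_gauge`. [cite: Balaban1985BackgroundPropagators, Thm 3.1 (3.42) p.397 (quantifier template, entries: shapes); (3.35) p.396, (3.52) p.400, (3.63)–(3.65) pp.402–403 (shapes, mechanism)] -/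
theorem hasMaj_v1GC_entries (htri : Triangle254 g) (hd : ∀ a b : g.Site, 0 ≤ g.dist a b) {σ cr : ℝ} (hσ : 0 ≤ σ) (hcr : 0 ≤ cr) (hrow : RowSum g σ cr)
    {s : J → X ≃ X} {s' : J → X' ≃ X'} {N : ℕ}
    {δ β m₀ θ c c' a₀ M α₀ η η' Cπ : ℝ} (hσδ : σ ≤ δ) (hβ : 0 ≤ β) (hm₀ : 0 ≤ m₀) (hθ : 0 ≤ θ)
    (hcomm : ∀ μ κ x, (s' μ).symm (s' κ x) = s' κ ((s' μ).symm x)) (hCπ : 0 ≤ Cπ)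
    (hconn : ∀ (f : X' → 𝔄) (b : ℝ), (∀ κ x, ‖f (s' κ x) - f x‖ ≤ b) → ∀ x₁ x₂, π x₁ = π x₂ → ‖f x₁ - f x₂‖ ≤ Cπ * b)
    (hblk : ∀ μ x', π ((s' μ ^ N) x') = s μ (π x')) (hη' : 0 < η') (hη'η : η' ≤ η) (hη1 : η ≤ 1) (hηθ : η ≤ θ) (hN : η = N * η')
    (hc : 0 ≤ c) (hc'0 : 0 < c') (hcc' : (2 + Fintype.card J) * c ≤ c') (hθ' : (1 + Fintype.card J) * Cπ * (c * M * α₀) * η' ≤ c' * M * α₀ * θ)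
    (hM : 1 ≤ M) (hα₀ : 0 < α₀) (hMα : M * α₀ ≤ a₀) (ha₀ : 0 ≤ a₀) (ha₀1 : 2 * (2 * c' * a₀) ≤ 1)
    (hq : β * (gV1c35 J (basisConst e) (2 * c') * a₀) * cr ≤ 1 / 2)
    (hG : HasMaj (BlockNorm.ofBlocks g (liftBlk blk ι)) (BlockNorm.ofBlocks g (liftBlk blk ι)) G (fun y y' => β * Real.exp (-(δ * g.dist y y'))))
    (hD : ∀ μ, HasMaj (BlockNorm.ofBlocks g (liftBlk blk ι)) (BlockNorm.ofBlocks g (liftBlk blk ι)) (D μ) (fun y y' => β * Real.exp (-(δ * g.dist y y'))))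
    (hG' : HasMaj (BlockNorm.ofBlocks g (liftBlk (blk ∘ π) ι)) (BlockNorm.ofBlocks g (liftBlk (blk ∘ π) ι)) G' (fun y y' => β * Real.exp (-(δ * g.dist y y'))))
    (hD' : ∀ μ, HasMaj (BlockNorm.ofBlocks g (liftBlk (blk ∘ π) ι)) (BlockNorm.ofBlocks g (liftBlk (blk ∘ π) ι)) (D' μ) (fun y y' => β * Real.exp (-(δ * g.dist y y'))))
    (hS : HasMaj (BlockNorm.ofBlocks g (liftBlk blk ι)) (BlockNorm.ofBlocks g (liftBlk blk ι)) S (fun y y' => β * Real.exp (-(δ * g.dist y y'))))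
    (hSD : ∀ μ, HasMaj (BlockNorm.ofBlocks g (liftBlk blk ι)) (BlockNorm.ofBlocks g (liftBlk blk ι)) (SD μ) (fun y y' => β * Real.exp (-(δ * g.dist y y'))))
    (hD₃' : HasMaj (BlockNorm.ofBlocks g (liftBlk (blk ∘ π) ι)) (BlockNorm.ofBlocks g (liftBlk (blk ∘ π) ι)) D₃' (fun y y' => β * Real.exp (-(δ * g.dist y y'))))
    (hDG : HasMaj (BlockNorm.ofBlocks g (liftBlk blk ι)) (BlockNorm.ofBlocks g (liftBlk (blk ∘ π) ι))
      (idef (pull (liftMap π ι)) (pull (liftMap π ι)) G' G) (fun y y' => m₀ * θ * Real.exp (-(δ * g.dist y y'))))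
    (hDD : ∀ μ, HasMaj (BlockNorm.ofBlocks g (liftBlk blk ι)) (BlockNorm.ofBlocks g (liftBlk (blk ∘ π) ι))
      (idef (pull (liftMap π ι)) (pull (liftMap π ι)) (D' μ) (D μ)) (fun y y' => m₀ * θ * Real.exp (-(δ * g.dist y y'))))
    (hDS : HasMaj (BlockNorm.ofBlocks g (liftBlk blk ι)) (BlockNorm.ofBlocks g (liftBlk (blk ∘ π) ι))
      (idef (pull (liftMap π ι)) (pull (liftMap π ι)) S' S) (fun y y' => m₀ * θ * Real.exp (-(δ * g.dist y y'))))
    (hDSD : ∀ μ, HasMaj (BlockNorm.ofBlocks g (liftBlk blk ι)) (BlockNorm.ofBlocks g (liftBlk (blk ∘ π) ι))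
      (idef (pull (liftMap π ι)) (pull (liftMap π ι)) (SD' μ) (SD μ)) (fun y y' => m₀ * θ * Real.exp (-(δ * g.dist y y'))))
    (hDD₃ : HasMaj (BlockNorm.ofBlocks g (liftBlk blk ι)) (BlockNorm.ofBlocks g (liftBlk (blk ∘ π) ι))
      (idef (pull (liftMap π ι)) (pull (liftMap π ι)) D₃' D₃) (fun y y' => m₀ * θ * Real.exp (-(δ * g.dist y y'))))
    {A' : J → X' → 𝔄} (hreg : (v1GaugeBg 𝔄 J s' η' M).Reg335 c α₀ A') :
    (∀ j : Option (J ⊕ J), HasMaj (BlockNorm.ofBlocks g (liftBlk blk ι)) (BlockNorm.ofBlocks g (liftBlk (blk ∘ π) ι))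
      (idef (pull (liftMap π ι)) (pull (liftMap π ι)) (projO j ∘ₗ bgPairM G' D' (v1coefC e η' (v1fieldsOfGauge 𝔄 J s' η' A')) (v1coefA e η' (v1fieldsOfGauge 𝔄 J s' η' A')))
        (projO j ∘ₗ bgPairM G D (v1coefC e η (v1fieldsOfGauge 𝔄 J s η (gavgM 𝔄 J π A'))) (v1coefA e η (v1fieldsOfGauge 𝔄 J s η (gavgM 𝔄 J π A')))))
      (fun y y' => bgConst β cr m₀ (gV1c35 J (basisConst e) (2 * c')) a₀ * θ * Real.exp (-((δ - σ) * g.dist y y')))) ∧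
    HasMaj (BlockNorm.ofBlocks g (liftBlk blk ι)) (BlockNorm.ofBlocks g (liftBlk (blk ∘ π) ι))
      (idef (pull (liftMap π ι)) (pull (liftMap π ι))
        (projO none ∘ₗ bgSourceV (stack G' D') (stack S' SD') (unstackM (v1coefC e η' (v1fieldsOfGauge 𝔄 J s' η' A')) (v1coefA e η' (v1fieldsOfGauge 𝔄 J s' η' A'))))
        (projO none ∘ₗ bgSourceV (stack G D) (stack S SD) (unstackM (v1coefC e η (v1fieldsOfGauge 𝔄 J s η (gavgM 𝔄 J π A'))) (v1coefA e η (v1fieldsOfGauge 𝔄 J s η (gavgM 𝔄 J π A'))))))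
      (fun y y' => bgConst β cr m₀ (gV1c35 J (basisConst e) (2 * c')) a₀ * θ * Real.exp (-((δ - σ) * g.dist y y'))) ∧
    HasMaj (BlockNorm.ofBlocks g (liftBlk blk ι)) (BlockNorm.ofBlocks g (liftBlk (blk ∘ π) ι))
      (idef (pull (liftMap π ι)) (pull (liftMap π ι)) (bgDerivedV (stack G' D') D₃' (unstackM (v1coefC e η' (v1fieldsOfGauge 𝔄 J s' η' A')) (v1coefA e η' (v1fieldsOfGauge 𝔄 J s' η' A'))))
        (bgDerivedV (stack G D) D₃ (unstackM (v1coefC e η (v1fieldsOfGauge 𝔄 J s η (gavgM 𝔄 J π A'))) (v1coefA e η (v1fieldsOfGauge 𝔄 J s η (gavgM 𝔄 J π A'))))))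
      (fun y y' => bgConst1 β cr m₀ (gV1c35 J (basisConst e) (2 * c')) a₀ * θ * Real.exp (-((δ - σ) * g.dist y y'))) := by
  obtain ⟨hr₂0, hr₂a, hV, hV', hDV⟩ := v1C_letters_of_gauge e (g := g) blk π hcomm hCπ hconn hblk hη' hη'η hη1 hηθ hN hc hcc' hθ' hM hα₀ hMα ha₀1 hreg
  set R : ℝ := 16 * Real.exp 1 * (1 + Fintype.card J) * basisConst e * (2 * c' * M * α₀) * (1 + Fintype.card (J ⊕ J)) with hR_def
  have hJJ0 : (0 : ℝ) ≤ 1 + Fintype.card (J ⊕ J) := by positivity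
  have hR0 : 0 ≤ R := mul_nonneg hr₂0 hJJ0
  have hκ : 0 ≤ basisConst e := basisConst_nonneg e
  have hca : 0 ≤ 2 * c' * a₀ := by positivity
  have hRa : R ≤ gV1c35 J (basisConst e) (2 * c') * a₀ := by
    calc R ≤ 16 * Real.exp 1 * (1 + Fintype.card J) * basisConst e * (2 * c') * a₀ * (1 + Fintype.card (J ⊕ J)) := mul_le_mul_of_nonneg_right hr₂a hJJ0
      _ = (16 * Real.exp 1 * (1 + Fintype.card J) * (1 + Fintype.card (J ⊕ J)) * (2 * c' * a₀)) * basisConst e := by ring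
      _ ≤ (16 * Real.exp 1 * (1 + Fintype.card J) * (1 + Fintype.card (J ⊕ J)) * (2 * c' * a₀)) * (1 + basisConst e) :=
          mul_le_mul_of_nonneg_left (by linarith) (by positivity)
      _ = gV1c35 J (basisConst e) (2 * c') * a₀ := by unfold gV1c35; ring
  have hRθ : 16 * Real.exp 1 * (1 + Fintype.card J) * basisConst e * (2 * c' * M * α₀) * θ * (1 + Fintype.card (J ⊕ J)) = R * θ := by rw [hR_def]; ring
  rw [hRθ] at hDV
  have hK : 0 ≤ gV1c35 J (basisConst e) (2 * c') := (le_gV1c35 (J := J) hκ (by positivity : 0 < 2 * c')).2.le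
  exact hasMaj_entries_of_letters (liftBlk blk ι) (liftMap π ι) htri hd hσ hcr hrow hσδ hβ hm₀ hθ hK ha₀ hq hR0 hRa hG hD hG' hD' hS hSD hD₃' hDG hDD
    hDS hDSD hDD₃ hV hV' hDV


end Guard

/-! ## §2 The entry operators, the kernel family, `EtaRateIneq342` per index -/

section Readout

variable {X X' J ι : Type} [Fintype X] [Fintype X'] [Fintype J] [Fintype ι] [DecidableEq X] [DecidableEq X'] [DecidableEq J] [DecidableEq ι]
  {𝔄 : Type} [NormedRing 𝔄] [NormedAlgebra ℝ 𝔄] [CompleteSpace 𝔄] (e : 𝔄 ≃L[ℝ] (ι → ℝ)) {g : B6.Geometry} (blk : X → g.Site) (π : X' → X)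

/-- THE FOUR ENTRY OPERATORS AT A GAUGE FIELD `A′` WITH THE PAIRING-CONSISTENT COARSE SIDE: fine coefficients of `V′₁` at the derived triple
`(A′, A′∘s′⁻¹, ∇′*A′)` (spacing `η′`), coarse ones at the derived triple `(Ā, Ā∘s⁻¹, ∇*Ā)` OF THE MEAN FIELD `Ā = gavgM π A′` (coarse shifts `s`, spacing `η`);
`U ≡ 1` pieces as in V2's four entry operators. [cite: Balaban1985BackgroundPropagators, (3.42) p.397 (the four entries: shape); (3.52) p.400 (shape)] -/
def v1GOpsC4 (s : J → X ≃ X) (s' : J → X' ≃ X') (η η' : ℝ) (ν : J ⊕ J) (G S D₃ : (X × ι → ℝ) →ₗ[ℝ] (X × ι → ℝ)) (D SD : J ⊕ J → (X × ι → ℝ) →ₗ[ℝ] (X × ι → ℝ))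
    (G' S' D₃' : (X' × ι → ℝ) →ₗ[ℝ] (X' × ι → ℝ)) (D' SD' : J ⊕ J → (X' × ι → ℝ) →ₗ[ℝ] (X' × ι → ℝ)) :
    Fin 4 → (J → X' → 𝔄) → ((X × ι → ℝ) →ₗ[ℝ] (X' × ι → ℝ)) :=
  fun n A' => ![idef (pull (liftMap π ι)) (pull (liftMap π ι)) (projO none ∘ₗ bgPairM G' D' (v1coefC e η' (v1fieldsOfGauge 𝔄 J s' η' A')) (v1coefA e η' (v1fieldsOfGauge 𝔄 J s' η' A')))
      (projO none ∘ₗ bgPairM G D (v1coefC e η (v1fieldsOfGauge 𝔄 J s η (gavgM 𝔄 J π A'))) (v1coefA e η (v1fieldsOfGauge 𝔄 J s η (gavgM 𝔄 J π A')))),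
    idef (pull (liftMap π ι)) (pull (liftMap π ι)) (projO (some ν) ∘ₗ bgPairM G' D' (v1coefC e η' (v1fieldsOfGauge 𝔄 J s' η' A')) (v1coefA e η' (v1fieldsOfGauge 𝔄 J s' η' A')))
      (projO (some ν) ∘ₗ bgPairM G D (v1coefC e η (v1fieldsOfGauge 𝔄 J s η (gavgM 𝔄 J π A'))) (v1coefA e η (v1fieldsOfGauge 𝔄 J s η (gavgM 𝔄 J π A')))),
    idef (pull (liftMap π ι)) (pull (liftMap π ι))
      (projO none ∘ₗ bgSourceV (stack G' D') (stack S' SD') (unstackM (v1coefC e η' (v1fieldsOfGauge 𝔄 J s' η' A')) (v1coefA e η' (v1fieldsOfGauge 𝔄 J s' η' A'))))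
      (projO none ∘ₗ bgSourceV (stack G D) (stack S SD) (unstackM (v1coefC e η (v1fieldsOfGauge 𝔄 J s η (gavgM 𝔄 J π A'))) (v1coefA e η (v1fieldsOfGauge 𝔄 J s η (gavgM 𝔄 J π A'))))),
    idef (pull (liftMap π ι)) (pull (liftMap π ι)) (bgDerivedV (stack G' D') D₃' (unstackM (v1coefC e η' (v1fieldsOfGauge 𝔄 J s' η' A')) (v1coefA e η' (v1fieldsOfGauge 𝔄 J s' η' A'))))
      (bgDerivedV (stack G D) D₃ (unstackM (v1coefC e η (v1fieldsOfGauge 𝔄 J s η (gavgM 𝔄 J π A'))) (v1coefA e η (v1fieldsOfGauge 𝔄 J s η (gavgM 𝔄 J π A')))))] n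

/-- THE KERNEL FAMILY over the GAUGE carrier with the pairing-consistent coarse side (g0 `opFamily`), spacings `η = g.eta`, `η′ = η·(L^n)⁻¹`; same paired
instance `v1GaugeInstance` as g3's `v1GFamily4`. [cite: Balaban1985BackgroundPropagators, (3.42) p.397 (shape)] -/
def v1GCFamily4 (s : J → X ≃ X) (s' : J → X' ≃ X') (n : ℕ) (hL : g.L ≠ 0) (ν : J ⊕ J) (G S D₃ : (X × ι → ℝ) →ₗ[ℝ] (X × ι → ℝ))
    (D SD : J ⊕ J → (X × ι → ℝ) →ₗ[ℝ] (X × ι → ℝ)) (G' S' D₃' : (X' × ι → ℝ) →ₗ[ℝ] (X' × ι → ℝ)) (D' SD' : J ⊕ J → (X' × ι → ℝ) →ₗ[ℝ] (X' × ι → ℝ)) :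
    B9.KernelFamily (v1GaugeInstance 𝔄 J ι blk π s s' n hL).gc (v1GaugeInstance 𝔄 J ι blk π s s' n hL).Bf :=
  show B9.KernelFamily (opGeo g (X × ι) (liftBlk blk ι)) (v1GaugeBg 𝔄 J s' (g.eta * (g.L ^ n)⁻¹) g.M) from
    opFamily (g := g) (B := v1GaugeBg 𝔄 J s' (g.eta * (g.L ^ n)⁻¹) g.M) (liftBlk blk ι) (liftBlk (blk ∘ π) ι)
      (v1GOpsC4 e π s s' g.eta (g.eta * (g.L ^ n)⁻¹) ν G S D₃ D SD G' S' D₃' D' SD')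

variable {G S D₃ : (X × ι → ℝ) →ₗ[ℝ] (X × ι → ℝ)} {D SD : J ⊕ J → (X × ι → ℝ) →ₗ[ℝ] (X × ι → ℝ)} {G' S' D₃' : (X' × ι → ℝ) →ₗ[ℝ] (X' × ι → ℝ)}
  {D' SD' : J ⊕ J → (X' × ι → ℝ) →ₗ[ℝ] (X' × ι → ℝ)}

/-- **`EtaRateIneq342` PER INDEX, GAUGE FIELD LIVE, COARSE SIDE AT THE MEAN FIELD's TRIPLE, EXPLICIT CONSTANTS** (`B₀ = bgConst + bgConst1` at
`gV1c35(2c′)`, `δ₀ = δ − σ`), for every C²-regular `A′` under the guard. [cite: Balaban1985BackgroundPropagators, Thm 3.1 (3.42) p.397 (shape, quantifier template)] -/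
theorem etaRateIneq342_v1GC (htri : Triangle254 g) (hd : ∀ a b : g.Site, 0 ≤ g.dist a b) {σ cr : ℝ} (hσ : 0 ≤ σ) (hcr : 0 ≤ cr) (hrow : RowSum g σ cr)
    (hη : 0 < g.eta) (hL : 0 < g.L) (hlen : ∀ y, 1 ≤ g.len y) {s : J → X ≃ X} {s' : J → X' ≃ X'} {N : ℕ} {δ β m₀ θ c c' a₀ M α₀ γ η' Cπ : ℝ}
    (hσδ : σ ≤ δ) (hβ : 0 ≤ β) (hm₀ : 0 ≤ m₀) (hθ : 0 ≤ θ) (hθγ : ∀ y, θ ≤ rateWeight g γ y)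
    (hcomm : ∀ μ κ x, (s' μ).symm (s' κ x) = s' κ ((s' μ).symm x)) (hCπ : 0 ≤ Cπ)
    (hconn : ∀ (f : X' → 𝔄) (b : ℝ), (∀ κ x, ‖f (s' κ x) - f x‖ ≤ b) → ∀ x₁ x₂, π x₁ = π x₂ → ‖f x₁ - f x₂‖ ≤ Cπ * b)
    (hblk : ∀ μ x', π ((s' μ ^ N) x') = s μ (π x')) (hη' : 0 < η') (hη'η : η' ≤ g.eta) (hη1 : g.eta ≤ 1) (hηθ : g.eta ≤ θ) (hN : g.eta = N * η')
    (hc : 0 ≤ c) (hc'0 : 0 < c') (hcc' : (2 + Fintype.card J) * c ≤ c') (hθ' : (1 + Fintype.card J) * Cπ * (c * M * α₀) * η' ≤ c' * M * α₀ * θ)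
    (hM : 1 ≤ M) (hα₀ : 0 < α₀) (hMα : M * α₀ ≤ a₀) (ha₀ : 0 ≤ a₀) (ha₀1 : 2 * (2 * c' * a₀) ≤ 1)
    (hq : β * (gV1c35 J (basisConst e) (2 * c') * a₀) * cr ≤ 1 / 2) {ν : J ⊕ J}
    (hG : HasMaj (BlockNorm.ofBlocks g (liftBlk blk ι)) (BlockNorm.ofBlocks g (liftBlk blk ι)) G (fun y y' => β * Real.exp (-(δ * g.dist y y'))))
    (hD : ∀ μ, HasMaj (BlockNorm.ofBlocks g (liftBlk blk ι)) (BlockNorm.ofBlocks g (liftBlk blk ι)) (D μ) (fun y y' => β * Real.exp (-(δ * g.dist y y'))))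
    (hG' : HasMaj (BlockNorm.ofBlocks g (liftBlk (blk ∘ π) ι)) (BlockNorm.ofBlocks g (liftBlk (blk ∘ π) ι)) G' (fun y y' => β * Real.exp (-(δ * g.dist y y'))))
    (hD' : ∀ μ, HasMaj (BlockNorm.ofBlocks g (liftBlk (blk ∘ π) ι)) (BlockNorm.ofBlocks g (liftBlk (blk ∘ π) ι)) (D' μ) (fun y y' => β * Real.exp (-(δ * g.dist y y'))))
    (hS : HasMaj (BlockNorm.ofBlocks g (liftBlk blk ι)) (BlockNorm.ofBlocks g (liftBlk blk ι)) S (fun y y' => β * Real.exp (-(δ * g.dist y y'))))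
    (hSD : ∀ μ, HasMaj (BlockNorm.ofBlocks g (liftBlk blk ι)) (BlockNorm.ofBlocks g (liftBlk blk ι)) (SD μ) (fun y y' => β * Real.exp (-(δ * g.dist y y'))))
    (hD₃' : HasMaj (BlockNorm.ofBlocks g (liftBlk (blk ∘ π) ι)) (BlockNorm.ofBlocks g (liftBlk (blk ∘ π) ι)) D₃' (fun y y' => β * Real.exp (-(δ * g.dist y y'))))
    (hDG : HasMaj (BlockNorm.ofBlocks g (liftBlk blk ι)) (BlockNorm.ofBlocks g (liftBlk (blk ∘ π) ι))
      (idef (pull (liftMap π ι)) (pull (liftMap π ι)) G' G) (fun y y' => m₀ * θ * Real.exp (-(δ * g.dist y y'))))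
    (hDD : ∀ μ, HasMaj (BlockNorm.ofBlocks g (liftBlk blk ι)) (BlockNorm.ofBlocks g (liftBlk (blk ∘ π) ι))
      (idef (pull (liftMap π ι)) (pull (liftMap π ι)) (D' μ) (D μ)) (fun y y' => m₀ * θ * Real.exp (-(δ * g.dist y y'))))
    (hDS : HasMaj (BlockNorm.ofBlocks g (liftBlk blk ι)) (BlockNorm.ofBlocks g (liftBlk (blk ∘ π) ι))
      (idef (pull (liftMap π ι)) (pull (liftMap π ι)) S' S) (fun y y' => m₀ * θ * Real.exp (-(δ * g.dist y y'))))
    (hDSD : ∀ μ, HasMaj (BlockNorm.ofBlocks g (liftBlk blk ι)) (BlockNorm.ofBlocks g (liftBlk (blk ∘ π) ι))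
      (idef (pull (liftMap π ι)) (pull (liftMap π ι)) (SD' μ) (SD μ)) (fun y y' => m₀ * θ * Real.exp (-(δ * g.dist y y'))))
    (hDD₃ : HasMaj (BlockNorm.ofBlocks g (liftBlk blk ι)) (BlockNorm.ofBlocks g (liftBlk (blk ∘ π) ι))
      (idef (pull (liftMap π ι)) (pull (liftMap π ι)) D₃' D₃) (fun y y' => m₀ * θ * Real.exp (-(δ * g.dist y y'))))
    {A' : J → X' → 𝔄} (hreg : (v1GaugeBg 𝔄 J s' η' M).Reg335 c α₀ A') :
    EtaRateIneq342 (opFamily (g := g) (B := v1GaugeBg 𝔄 J s' η' M) (liftBlk blk ι) (liftBlk (blk ∘ π) ι)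
        (v1GOpsC4 e π s s' g.eta η' ν G S D₃ D SD G' S' D₃' D' SD'))
      (bgConst β cr m₀ (gV1c35 J (basisConst e) (2 * c')) a₀ + bgConst1 β cr m₀ (gV1c35 J (basisConst e) (2 * c')) a₀) (δ - σ) γ A' := by
  obtain ⟨h01, h2, h3⟩ := hasMaj_v1GC_entries e blk π htri hd hσ hcr hrow hσδ hβ hm₀ hθ hcomm hCπ hconn hblk hη' hη'η hη1 hηθ hN hc hc'0 hcc' hθ'
    hM hα₀ hMα ha₀ ha₀1 hq hG hD hG' hD' hS hSD hD₃' hDG hDD hDS hDSD hDD₃ hreg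
  have hgc : 0 ≤ gV1c35 J (basisConst e) (2 * c') := (le_gV1c35 (J := J) (basisConst_nonneg e) (by positivity : 0 < 2 * c')).2.le
  have hC0 : 0 ≤ bgConst β cr m₀ (gV1c35 J (basisConst e) (2 * c')) a₀ := bgConst_nonneg hβ hcr hm₀ hgc ha₀
  have hC1 : 0 ≤ bgConst1 β cr m₀ (gV1c35 J (basisConst e) (2 * c')) a₀ := bgConst1_nonneg hβ hcr hm₀ hgc ha₀
  refine etaRateIneq342_of_hasMaj (g := g) (B := v1GaugeBg 𝔄 J s' η' M) (liftBlk blk ι) (liftBlk (blk ∘ π) ι) hη.le hL.le (add_nonneg hC0 hC1)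
    (v1GOpsC4 e π s s' g.eta η' ν G S D₃ D SD G' S' D₃' D' SD') A' fun n => ?_
  have hdom0 := fun n (y y' : g.Site) =>
    entryMajorant_le_etaRateShape (X := X × ι) (liftBlk blk ι) hη hL hlen (δ₀ := δ - σ) hθ hθγ hC0 (le_add_of_nonneg_right hC1) n y y'
  have hdom1 := fun n (y y' : g.Site) =>
    entryMajorant_le_etaRateShape (X := X × ι) (liftBlk blk ι) hη hL hlen (δ₀ := δ - σ) hθ hθγ hC1 (le_add_of_nonneg_left hC0) n y y'
  fin_cases n
  · exact (h01 none).mono (hdom0 0)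
  · exact (h01 (some ν)).mono (hdom0 1)
  · exact h2.mono (hdom0 2)
  · exact h3.mono (hdom1 3)

end Readout

/-! ## §3 The node theorem -/

section Node

variable {I J ι : Type} [Fintype J] [DecidableEq J] [Fintype ι] [DecidableEq ι] {𝔄 : Type} [NormedRing 𝔄] [NormedAlgebra ℝ 𝔄] [CompleteSpace 𝔄]
  (e : 𝔄 ≃L[ℝ] (ι → ℝ)) (g : I → B6.Geometry) (X X' : I → Type) [∀ i, Fintype (X i)] [∀ i, Fintype (X' i)] [∀ i, DecidableEq (X i)]
  [∀ i, DecidableEq (X' i)] (blk : ∀ i, X i → (g i).Site) (π : ∀ i, X' i → X i) (s : ∀ i, J → X i ≃ X i) (s' : ∀ i, J → X' i ≃ X' i) (nsh Nst : I → ℕ)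
  (hL0 : ∀ i, (g i).L ≠ 0) (θ Cπ : I → ℝ) (ν : I → J ⊕ J)
  (G S D₃ : ∀ i, (X i × ι → ℝ) →ₗ[ℝ] (X i × ι → ℝ)) (D SD : ∀ i, J ⊕ J → (X i × ι → ℝ) →ₗ[ℝ] (X i × ι → ℝ))
  (G' S' D₃' : ∀ i, (X' i × ι → ℝ) →ₗ[ℝ] (X' i × ι → ℝ)) (D' SD' : ∀ i, J ⊕ J → (X' i × ι → ℝ) →ₗ[ℝ] (X' i × ι → ℝ))

/-- **NE2⁺, OPERATOR LAYER — `T4EtaRate.NE2PlusOperator` BY NAME, GAUGE FIELD LIVE, COARSE `V′₁` AT THE MEAN FIELD's OWN TRIPLE.**  g3's `ne2PlusOperator_v1G`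
with ONE hypothesis more — the BLOCK-TRANSLATION LAW `π_i∘(s′_{i,μ})^{N_i} = s_{i,μ}∘π_i` with `η_i = N_i·η′_i` (King's cubes: `N = L^m`, sequel) — and the families
`v1GCFamily4` (coarse coefficients at `(Ā, Ā∘s⁻¹, ∇*Ā)`, `Ā = gavgM π A′`, instead of the mean of the fine triple): `NE2PlusOperator c₃₅` with `M₅ = 1`,
`a₀ = (2·gV1c35(2c′)·(βc_r + 1))⁻¹`, `c′ = (2+|J|)(1+C₀)c₃₅`, `B₀ = bgConst + bgConst1 + 1`, `δ₀ = δ − σ`.  Inside: `etaRateIneq342_v1GC`.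
[cite: Balaban1985BackgroundPropagators, Thm 3.1 p.397 (quantifier template); (3.35) p.396, (3.42) p.397, (3.44) p.398, (3.52) p.400, (3.63)–(3.65) pp.402–403 (shapes, mechanism)] -/
theorem ne2PlusOperator_v1GC (c35 : ℝ) (hc35 : 0 < c35)
    (htri : ∀ i, Triangle254 (g i)) (hd : ∀ i (a b : (g i).Site), 0 ≤ (g i).dist a b) {σ cr : ℝ} (hσ : 0 ≤ σ) (hcr : 0 ≤ cr)
    (hrow : ∀ i, RowSum (g i) σ cr) (hη : ∀ i, 0 < (g i).eta) (hη1 : ∀ i, (g i).eta ≤ 1) (hηθ : ∀ i, (g i).eta ≤ θ i) (hL : ∀ i, 1 ≤ (g i).L)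
    (hlen : ∀ i y, 1 ≤ (g i).len y) {δ β m₀ γ : ℝ} (hσδ : σ < δ) (hβ : 0 ≤ β) (hm₀ : 0 ≤ m₀) (hγ : 0 < γ) (hθγ : ∀ i y, θ i ≤ rateWeight (g i) γ y)
    (hcomm : ∀ i μ κ x, (s' i μ).symm (s' i κ x) = s' i κ ((s' i μ).symm x)) (hCπ : ∀ i, 0 ≤ Cπ i)
    (hconn : ∀ i (f : X' i → 𝔄) (b : ℝ), (∀ κ x, ‖f (s' i κ x) - f x‖ ≤ b) → ∀ x₁ x₂, π i x₁ = π i x₂ → ‖f x₁ - f x₂‖ ≤ Cπ i * b)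
    {C₀ : ℝ} (hC₀ : 0 ≤ C₀) (hCθ : ∀ i, Cπ i * ((g i).eta * ((g i).L ^ nsh i)⁻¹) ≤ C₀ * θ i)
    (hblk : ∀ i μ x', π i ((s' i μ ^ Nst i) x') = s i μ (π i x')) (hN : ∀ i, (g i).eta = Nst i * ((g i).eta * ((g i).L ^ nsh i)⁻¹))
    (hG : ∀ i, HasMaj (BlockNorm.ofBlocks (g i) (liftBlk (blk i) ι)) (BlockNorm.ofBlocks (g i) (liftBlk (blk i) ι)) (G i)
      (fun y y' => β * Real.exp (-(δ * (g i).dist y y'))))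
    (hD : ∀ i μ, HasMaj (BlockNorm.ofBlocks (g i) (liftBlk (blk i) ι)) (BlockNorm.ofBlocks (g i) (liftBlk (blk i) ι)) (D i μ)
      (fun y y' => β * Real.exp (-(δ * (g i).dist y y'))))
    (hG' : ∀ i, HasMaj (BlockNorm.ofBlocks (g i) (liftBlk (blk i ∘ π i) ι)) (BlockNorm.ofBlocks (g i) (liftBlk (blk i ∘ π i) ι)) (G' i)
      (fun y y' => β * Real.exp (-(δ * (g i).dist y y'))))
    (hD' : ∀ i μ, HasMaj (BlockNorm.ofBlocks (g i) (liftBlk (blk i ∘ π i) ι)) (BlockNorm.ofBlocks (g i) (liftBlk (blk i ∘ π i) ι)) (D' i μ)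
      (fun y y' => β * Real.exp (-(δ * (g i).dist y y'))))
    (hS : ∀ i, HasMaj (BlockNorm.ofBlocks (g i) (liftBlk (blk i) ι)) (BlockNorm.ofBlocks (g i) (liftBlk (blk i) ι)) (S i)
      (fun y y' => β * Real.exp (-(δ * (g i).dist y y'))))
    (hSD : ∀ i μ, HasMaj (BlockNorm.ofBlocks (g i) (liftBlk (blk i) ι)) (BlockNorm.ofBlocks (g i) (liftBlk (blk i) ι)) (SD i μ)
      (fun y y' => β * Real.exp (-(δ * (g i).dist y y'))))
    (hD₃' : ∀ i, HasMaj (BlockNorm.ofBlocks (g i) (liftBlk (blk i ∘ π i) ι)) (BlockNorm.ofBlocks (g i) (liftBlk (blk i ∘ π i) ι)) (D₃' i)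
      (fun y y' => β * Real.exp (-(δ * (g i).dist y y'))))
    (hDG : ∀ i, HasMaj (BlockNorm.ofBlocks (g i) (liftBlk (blk i) ι)) (BlockNorm.ofBlocks (g i) (liftBlk (blk i ∘ π i) ι))
      (idef (pull (liftMap (π i) ι)) (pull (liftMap (π i) ι)) (G' i) (G i)) (fun y y' => m₀ * θ i * Real.exp (-(δ * (g i).dist y y'))))
    (hDD : ∀ i μ, HasMaj (BlockNorm.ofBlocks (g i) (liftBlk (blk i) ι)) (BlockNorm.ofBlocks (g i) (liftBlk (blk i ∘ π i) ι))
      (idef (pull (liftMap (π i) ι)) (pull (liftMap (π i) ι)) (D' i μ) (D i μ)) (fun y y' => m₀ * θ i * Real.exp (-(δ * (g i).dist y y'))))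
    (hDS : ∀ i, HasMaj (BlockNorm.ofBlocks (g i) (liftBlk (blk i) ι)) (BlockNorm.ofBlocks (g i) (liftBlk (blk i ∘ π i) ι))
      (idef (pull (liftMap (π i) ι)) (pull (liftMap (π i) ι)) (S' i) (S i)) (fun y y' => m₀ * θ i * Real.exp (-(δ * (g i).dist y y'))))
    (hDSD : ∀ i μ, HasMaj (BlockNorm.ofBlocks (g i) (liftBlk (blk i) ι)) (BlockNorm.ofBlocks (g i) (liftBlk (blk i ∘ π i) ι))
      (idef (pull (liftMap (π i) ι)) (pull (liftMap (π i) ι)) (SD' i μ) (SD i μ)) (fun y y' => m₀ * θ i * Real.exp (-(δ * (g i).dist y y'))))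
    (hDD₃ : ∀ i, HasMaj (BlockNorm.ofBlocks (g i) (liftBlk (blk i) ι)) (BlockNorm.ofBlocks (g i) (liftBlk (blk i ∘ π i) ι))
      (idef (pull (liftMap (π i) ι)) (pull (liftMap (π i) ι)) (D₃' i) (D₃ i)) (fun y y' => m₀ * θ i * Real.exp (-(δ * (g i).dist y y')))) :
    NE2PlusOperator c35 (fun i => v1GaugeInstance 𝔄 J ι (blk i) (π i) (s i) (s' i) (nsh i) (hL0 i))
      (fun i => v1GCFamily4 e (blk i) (π i) (s i) (s' i) (nsh i) (hL0 i) (ν i) (G i) (S i) (D₃ i) (D i) (SD i) (G' i) (S' i) (D₃' i) (D' i) (SD' i)) := by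
  -- the effective (3.35) constant of the derived triple
  have hJ0 : (0 : ℝ) ≤ Fintype.card J := Nat.cast_nonneg _
  set c' : ℝ := (2 + Fintype.card J) * (1 + C₀) * c35 with hc'
  have hc'pos : 0 < c' := by positivity
  have h2c'pos : 0 < 2 * c' := by positivity
  obtain ⟨hcg, hgpos⟩ := le_gV1c35 (J := J) (basisConst_nonneg e) h2c'pos
  set a₀ : ℝ := (2 * gV1c35 J (basisConst e) (2 * c') * (β * cr + 1))⁻¹ with ha₀_def
  have hden : 0 < 2 * gV1c35 J (basisConst e) (2 * c') * (β * cr + 1) := by positivity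
  have ha₀ : 0 < a₀ := inv_pos.2 hden
  have hq : β * (gV1c35 J (basisConst e) (2 * c') * a₀) * cr ≤ 1 / 2 := by
    have h1 : β * (gV1c35 J (basisConst e) (2 * c') * a₀) * cr = (β * cr) * (gV1c35 J (basisConst e) (2 * c') * a₀) := by ring
    have h2 : gV1c35 J (basisConst e) (2 * c') * a₀ = (2 * (β * cr + 1))⁻¹ := by
      rw [ha₀_def]; field_simp
    rw [h1, h2, ← div_eq_mul_inv, div_le_iff₀ (by positivity)]
    nlinarith [mul_nonneg hβ hcr]
  have ha₀1 : 2 * (2 * c' * a₀) ≤ 1 := by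
    have h2 : 2 * (2 * c' * a₀) = (2 * c') / (gV1c35 J (basisConst e) (2 * c') * (β * cr + 1)) := by
      rw [ha₀_def]; field_simp
    rw [h2, div_le_one (by positivity)]
    nlinarith [mul_nonneg hβ hcr, hgpos]
  have hC0 : 0 ≤ bgConst β cr m₀ (gV1c35 J (basisConst e) (2 * c')) a₀ := bgConst_nonneg hβ hcr hm₀ hgpos.le ha₀.le
  have hC1 : 0 ≤ bgConst1 β cr m₀ (gV1c35 J (basisConst e) (2 * c')) a₀ := bgConst1_nonneg hβ hcr hm₀ hgpos.le ha₀.le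
  refine ⟨1, δ - σ, a₀, bgConst β cr m₀ (gV1c35 J (basisConst e) (2 * c')) a₀ + bgConst1 β cr m₀ (gV1c35 J (basisConst e) (2 * c')) a₀ + 1, γ, one_pos, by linarith,
    ha₀, by linarith, hγ, fun i hM α₀ hα₀ hMα A' hreg => ?_⟩
  have hM' : 1 ≤ (g i).M := hM
  have hMα' : (g i).M * α₀ ≤ a₀ := hMα
  have hM0 : 0 ≤ (g i).M := zero_le_one.trans hM'
  have hLpos : 0 < (g i).L := lt_of_lt_of_le one_pos (hL i)
  have hη'pos : 0 < (g i).eta * ((g i).L ^ nsh i)⁻¹ := mul_pos (hη i) (inv_pos.2 (pow_pos hLpos _))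
  have hη'0 : 0 ≤ (g i).eta * ((g i).L ^ nsh i)⁻¹ := hη'pos.le
  have hη'η : (g i).eta * ((g i).L ^ nsh i)⁻¹ ≤ (g i).eta := by
    have h1 : ((g i).L ^ nsh i)⁻¹ ≤ 1 := inv_le_one_of_one_le₀ (one_le_pow₀ (hL i))
    calc (g i).eta * ((g i).L ^ nsh i)⁻¹ ≤ (g i).eta * 1 := mul_le_mul_of_nonneg_left h1 (hη i).le
      _ = (g i).eta := mul_one _
  have hθ0 : 0 ≤ θ i := (hη i).le.trans (hηθ i)
  -- the constants of `v1C_letters_of_gauge` at `c′ = (2+|J|)(1+C₀)c₃₅`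
  have hcc' : (2 + Fintype.card J) * c35 ≤ c' := by
    rw [hc']
    have h0 : 0 ≤ (2 + Fintype.card J) * c35 := by positivity
    nlinarith [mul_nonneg hC₀ h0]
  have hθ' : (1 + Fintype.card J) * Cπ i * (c35 * (g i).M * α₀) * ((g i).eta * ((g i).L ^ nsh i)⁻¹) ≤ c' * (g i).M * α₀ * θ i := by
    have h0 : 0 ≤ (1 + Fintype.card J) * (c35 * (g i).M * α₀) := by positivity
    have hMα0 : 0 ≤ (g i).M * α₀ := mul_nonneg hM0 hα₀.le
    have hcoef : (1 + Fintype.card J) * C₀ * c35 ≤ c' := by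
      rw [hc']; nlinarith [mul_nonneg hC₀ hJ0, hc35.le, mul_nonneg (mul_nonneg hC₀ hJ0) hc35.le, mul_nonneg hJ0 hc35.le, mul_nonneg hC₀ hc35.le]
    calc (1 + Fintype.card J) * Cπ i * (c35 * (g i).M * α₀) * ((g i).eta * ((g i).L ^ nsh i)⁻¹)
        = (1 + Fintype.card J) * (c35 * (g i).M * α₀) * (Cπ i * ((g i).eta * ((g i).L ^ nsh i)⁻¹)) := by ring
      _ ≤ (1 + Fintype.card J) * (c35 * (g i).M * α₀) * (C₀ * θ i) := mul_le_mul_of_nonneg_left (hCθ i) h0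
      _ = ((1 + Fintype.card J) * C₀ * c35) * ((g i).M * α₀) * θ i := by ring
      _ ≤ c' * ((g i).M * α₀) * θ i := mul_le_mul_of_nonneg_right (mul_le_mul_of_nonneg_right hcoef hMα0) hθ0
      _ = c' * (g i).M * α₀ * θ i := by ring
  have key := etaRateIneq342_v1GC e (J := J) (blk i) (π i) (htri i) (hd i) hσ hcr (hrow i) (hη i) hLpos (hlen i) hσδ.le hβ hm₀ hθ0 (hθγ i)
    (hcomm i) (hCπ i) (hconn i) (hblk i) hη'pos hη'η (hη1 i) (hηθ i) (hN i) hc35.le hc'pos hcc' hθ' hM' hα₀ hMα' ha₀.le ha₀1 hq (ν := ν i)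
    (hG i) (hD i) (hG' i) (hD' i) (hS i) (hSD i) (hD₃' i) (hDG i) (hDD i) (hDS i) (hDSD i) (hDD₃ i) hreg
  intro n lam y y' hsupp
  refine (key n lam y y' hsupp).trans ?_
  have hpref : 0 ≤ B9.pref4 ((v1GaugeInstance 𝔄 J ι (blk i) (π i) (s i) (s' i) (nsh i) (hL0 i)).gc.len y) n := by
    have : 1 ≤ B9.pref4 ((opGeo (g i) (X i × ι) (liftBlk (blk i) ι)).len y) n := by rw [opGeo_len]; exact one_le_pref4 (hlen i y) n
    exact zero_le_one.trans this
  have hrf : 0 ≤ max (rateFactor (v1GaugeInstance 𝔄 J ι (blk i) (π i) (s i) (s' i) (nsh i) (hL0 i)).gc γ y)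
      (rateFactor (v1GaugeInstance 𝔄 J ι (blk i) (π i) (s i) (s' i) (nsh i) (hL0 i)).gc γ y') :=
    (T4EtaRate.rateFactor_nonneg (g := opGeo (g i) (X i × ι) (liftBlk (blk i) ι)) (hη i).le hLpos.le γ y).trans (le_max_left _ _)
  have hnorm : 0 ≤ (v1GaugeInstance 𝔄 J ι (blk i) (π i) (s i) (s' i) (nsh i) (hL0 i)).gc.supNorm lam := Real.iSup_nonneg fun x => abs_nonneg _
  have hE : 0 ≤ Real.exp (-((δ - σ) * (v1GaugeInstance 𝔄 J ι (blk i) (π i) (s i) (s' i) (nsh i) (hL0 i)).gc.dist y y')) := Real.exp_nonneg _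
  exact mul_le_mul_of_nonneg_right (mul_le_mul_of_nonneg_right (mul_le_mul_of_nonneg_right
    (mul_le_mul_of_nonneg_right (le_add_of_nonneg_right zero_le_one) hpref) hE) hrf) hnorm

end Node


end Summit.QuantumFields.YangMills.BalabanUVNodes.N15.BackgroundLayer

end
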